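import Summits.BirchSwinnertonDyer.Rank1Residual.O5.FlexNFCaseSKummerExistsThree
import Summits.BirchSwinnertonDyer.Rank1Residual.O5.FlexNFCaseSKummerCuspThree
import Summits.BirchSwinnertonDyer.Rank1Residual.O5.FlexNormalFormCaseSSignedLaw
import HarnessLib

/-!
# O5 — T30.6 v2 `FlexNFCaseSKummerSignedLawThree` PROVED AS TYPED (`_holds`): in Case S of the flex normal form
# `y² + 3b·xy + 3ᵃA₃·y = x³` over `ℚ₃` (`a ∈ {1, 2}`, `A₃ ≡ 1 (mod 3)`) the `φ̂`-Kummer image contains a très ramifié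
# class, lies in the line of `[3ᵃA₃]` when `cellS` says `k = 1`, and contains a unit class when `k = 2`
(cell `b2b-bsdres`, team n1011, ROW T-FLEX-KUM file F-S2b; seat `b2b-bsdres-n1011-p18` GEN 15, idle rule; theorems only;
 no typer / o5-r1 / pool file is edited; the `@[conjecture]` tag's retirement on the node is the typer's edit, not this file's)

HONEST FRAMING (cell `b2b-bsdres`, run/shared/lean/b2b/bsd-rank1-residual/, verbatim in every file): the
goal of the cell is to DELETE the COMBINATION-SHAPED residual classes of the Birch–Swinnerton-Dyer formula
for ALL analytic-rank `≤ 1` elliptic curves over `ℚ` — "full BSD formula for every rank `≤ 1` curve in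
class `C`" assembled STRICTLY from published theorems — so that the rank-`≤ 1` remainder becomes exactly
the CONSTRUCTION-SHAPED classes, which are TYPED (missing-input `Prop`s), NOT attempted. This is not
"finishing BSD". Lane CLASS-CLOSURE / O5 (O5 OPEN): research route; census output (P-K19) is EVIDENCE,
never a Literature fact; nothing is booked; no mark of `RESIDUAL-MAP.md` moves. This file: THEOREMS ONLY
(no definition, no named fact, no `@[conjecture]` node, no `sorry`; net named-fact debt `0`).  Closes NO pair
and moves NO mark; it is `3`-adic algebra about one cubic equation, read by the O5 lane (o5-r1 GEN 13, T30)
as the `φ̂`-Kummer image `δ(P) = y(P)·ℚ₃^{×3}` (Cohen–Pazuki Def. 1.3 / Prop. 2.2).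

## What is proved (the SECOND conjunct of the node; conjuncts 1 and 3 are F-S1 `O5/FlexNFCaseSKummerExistsThree.lean`,
## GEN 14: `nfKummerHasRamified_S`, `nfKummerHasUnit_S_of_cellS`)
* `cube_of_residue_one`: in the `k = 1` cells (`a = 1, b ≡ 2` / `a = 2, 3 ∣ b`), every `ℤ₃`-point with `x ≡ 1 (mod 3)` has
  `y ≡ ±1 (mod 9)`, a CUBE: with `x = 1 + 3ξ`, `y = ±(1 + 3η)` the equation reads `2η̄ + b̄ + 3ᵃ⁻¹Ā₃ ≡ 0 (mod 3)`, and the cell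
  condition is exactly `3 ∣ η` (`ℤ/9` checks `zmod9_key_one/two` by `decide`; the `−1` sign by the `−P` trick `y(P)·y(−P) = −x³`);
* `nfKummerInLineOfA₃_of_cellS`: **`(cellS a b).k = 1 → NFKummerInLineOfA₃ b A₃ a`** — non-integral points have `y` a cube
  (`ThreeTorsionNormalForm.exists_pow_three_eq_of_one_lt_norm`, x11b3-p7 p309913; `e = 0`), integral points reduce mod `3`
  to `(0,0)` (F-S2a `lineS_one` / `lineS_two`: `e ∈ {1, 2}`) or `(1, ±1)` (`e = 0`) of `ȳ² = x̄³` (`zmod3_points_S`);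
* **`flexNFCaseSKummerSignedLawThree_holds : FlexNFCaseSKummerSignedLawThree`** — the typer's v2 node
  (`O5/FlexNormalFormCaseSSignedLaw.lean`, p336580) EXACTLY AS TYPED, binder-free; and `kummerLawS_anySign`, the node file's
  any-sign reading `kummerLawS_of_signed` made unconditional.  A `_holds` closes no pair, moves no mark; census = EVIDENCE.
No group law, no Néron model / component group, no Tate run anywhere (T30 §1's "`E = ⟨P₀⟩ + E⁰`, `δ(E⁰) = ⟨[y(Q₁)]⟩`"
is replaced by the residue bookkeeping above).
References: S. Gajović, L. Radičević, M. Verzobio (2025), Thm. 55 (arXiv:2502.08583 p. 21) [GajovicRadicevicVerzobio2025];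
Bhargava–Klagsbrun–Lemke Oliver–Shnidman, Thm. 10.5 [BKLS2019ThreeIsogenySelmer]; H. Cohen, F. Pazuki, Acta Arith. 140 (2009),
Def. 1.3 / Prop. 2.2 [CohenPazuki2009ThreeDescent]; o5-r1 GEN 13 `T30-FLAT-KUMMER-NORMAL-FORM.md` §1 (T30.6; P-K19 = EVIDENCE).
-/

noncomputable section

open Padic

namespace Summit.BirchSwinnertonDyer.Rank1Residual.O5.FlexNormalForm

open KummerResidue

section CaseS

variable (b A₃ : ℤ) {X Y : ℤ_[3]}

/-! ### The residue class `(1, ±1)`: `y` is a cube -/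

/-- **Over `(1, ±1)`** (`k = 1` cells: `a = 1, b ≡ 2` or `a = 2, 3 ∣ b`; `A₃ ≡ 1 (mod 3)`): every `ℤ₃`-point of
`Y² + 3b·XY + 3ᵃA₃Y = X³` with `X ≡ 1 (mod 3)` has `Y ≡ ±1 (mod 9)`, a cube.  (Mod `9` the equation reads
`2η̄ + b̄ + 3ᵃ⁻¹Ā₃ ≡ 0 (mod 3)` for `Y = ±(1 + 3η)`; the cell condition is exactly `3 ∣ η`.) [folklore] -/
theorem cube_of_residue_one (a : ℕ) (hcell : (a = 1 ∧ b % 3 = 2) ∨ (a = 2 ∧ b % 3 = 0)) (hA : A₃ % 3 = 1)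
    (hE : Y ^ 2 + 3 * (b : ℤ_[3]) * X * Y + 3 ^ a * (A₃ : ℤ_[3]) * Y = X ^ 3) (hX0 : X ≠ 0)
    (hx : PadicInt.toZMod X = 1) (hy : PadicInt.toZMod Y = 1 ∨ PadicInt.toZMod Y = -1) :
    ∃ w : ℚ_[3], (Y : ℚ_[3]) = w ^ 3 := by
  have h9 : (9 : ZMod (3 ^ 2)) = 0 := by decide
  have h3A : (3 : ZMod (3 ^ 2)) * (A₃ : ZMod (3 ^ 2)) = 3 := by
    have := (ZMod.intCast_eq_intCast_iff' (3 * A₃) 3 (3 ^ 2)).2 (by norm_num; omega)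
    push_cast at this; exact this
  -- the `+1` branch, for any `Y` with residue `1` on this curve
  have plus : ∀ {Y : ℤ_[3]}, Y ^ 2 + 3 * (b : ℤ_[3]) * X * Y + 3 ^ a * (A₃ : ℤ_[3]) * Y = X ^ 3 →
      PadicInt.toZMod Y = 1 → ∃ w : ℚ_[3], (Y : ℚ_[3]) = w ^ 3 := by
    intro Y hE hy
    obtain ⟨ξ, hξ⟩ := exists_eq_add_three_mul (X := X) (c := 1) (by rw [hx]; push_cast; rfl)
    obtain ⟨η, hη⟩ := exists_eq_add_three_mul (X := Y) (c := 1) (by rw [hy]; push_cast; rfl)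
    push_cast at hξ hη
    have hE' : Y ^ 2 + 3 * (b : ℤ_[3]) * Y + 3 ^ a * (A₃ : ℤ_[3]) * Y - 1
        = 9 * (ξ + 3 * ξ ^ 2 + 3 * ξ ^ 3 - (b : ℤ_[3]) * ξ * Y) := by
      rw [hξ] at hE; linear_combination hE
    rw [hη] at hE'
    have img := congrArg (PadicInt.toZModPow 2) hE'
    rw [map_mul (PadicInt.toZModPow 2) 9, map_ofNat, h9, zero_mul] at img
    simp only [map_sub, map_add, map_mul, map_pow, map_ofNat, map_one, map_intCast] at img
    have hY9 : PadicInt.toZModPow 2 Y = 1 + 3 * PadicInt.toZModPow 2 η := by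
      rw [hη, map_add, map_one, map_mul, map_ofNat]
    apply exists_pow_three_eq_of_sq_eq_one
    rw [hY9]
    rcases hcell with ⟨rfl, hb⟩ | ⟨rfl, hb⟩
    · have h3b : (3 : ZMod (3 ^ 2)) * (b : ZMod (3 ^ 2)) = 6 := by
        have := (ZMod.intCast_eq_intCast_iff' (3 * b) 6 (3 ^ 2)).2 (by norm_num; omega)
        push_cast at this; exact this
      exact zmod9_key_one (PadicInt.toZModPow 2 η) (b : ZMod (3 ^ 2)) (A₃ : ZMod (3 ^ 2)) h3b h3A
        (by linear_combination img)
    · have h3b : (3 : ZMod (3 ^ 2)) * (b : ZMod (3 ^ 2)) = 0 := by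
        have := (ZMod.intCast_eq_intCast_iff' (3 * b) 0 (3 ^ 2)).2 (by norm_num; omega)
        push_cast at this; exact this
      exact zmod9_key_two (PadicInt.toZModPow 2 η) (b : ZMod (3 ^ 2)) (A₃ : ZMod (3 ^ 2)) h3b
        (by linear_combination img)
  rcases hy with hy | hy
  · exact plus hE hy
  · -- `−P` lies over `(1, 1)`; `Y·Y′ = −X³`
    set Y' : ℤ_[3] := -Y - 3 * (b : ℤ_[3]) * X - 3 ^ a * (A₃ : ℤ_[3]) with hY'
    have hE' : Y' ^ 2 + 3 * (b : ℤ_[3]) * X * Y' + 3 ^ a * (A₃ : ℤ_[3]) * Y' = X ^ 3 := by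
      rw [hY']; linear_combination hE
    have h30 : (3 : ZMod 3) = 0 := by decide
    have ha0 : a ≠ 0 := by rcases hcell with ⟨rfl, -⟩ | ⟨rfl, -⟩ <;> decide
    have hy' : PadicInt.toZMod Y' = 1 := by
      rw [hY']
      simp only [map_sub, map_neg, map_mul, map_pow, map_ofNat, map_intCast, hy, h30, zero_pow ha0, zero_mul,
        sub_zero, neg_neg]
    obtain ⟨w, hw⟩ := plus hE' hy'
    have hprod : (Y : ℚ_[3]) * (Y' : ℚ_[3]) = -(X : ℚ_[3]) ^ 3 := by
      have hZ : Y * Y' = -X ^ 3 := by rw [hY']; linear_combination -hE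
      have := congrArg (fun z : ℤ_[3] => (z : ℚ_[3])) hZ; push_cast at this; exact this
    have hX0' : (X : ℚ_[3]) ≠ 0 := PadicInt.coe_ne_zero.2 hX0
    have hw0 : w ≠ 0 := by
      rintro rfl
      refine hX0' (pow_eq_zero_iff three_ne_zero |>.1 ?_)
      rw [hw] at hprod; linear_combination hprod
    refine ⟨-(X : ℚ_[3]) / w, ?_⟩
    rw [hw] at hprod
    rw [div_pow, eq_div_iff (pow_ne_zero _ hw0)]
    linear_combination hprod

/-! ### Conjunct 2 of the node, and the node -/

/-- **`(cellS a b).k = 1 ⟹ NFKummerInLineOfA₃ b A₃ a`** for `a ∈ {1, 2}`, `A₃ ≡ 1 (mod 3)` — the SECOND conjunct of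
T30.6 v2.  `k = 1` iff `a = 1, b ≡ 2` or `a = 2, 3 ∣ b`; non-integral points have `y` a cube
(`ThreeTorsionNormalForm.exists_pow_three_eq_of_one_lt_norm`), integral ones reduce to `(0,0)` or `(1,±1)` of
`ȳ² = x̄³` and are covered by `lineS_one` / `lineS_two` / `cube_of_residue_one`. [folklore] -/
theorem nfKummerInLineOfA₃_of_cellS (a : ℕ) (ha : a = 1 ∨ a = 2) (hA : A₃ % 3 = 1)
    (hk : (cellS a b).k = 1) : NFKummerInLineOfA₃ b A₃ a := by
  have hcell : (a = 1 ∧ b % 3 = 2) ∨ (a = 2 ∧ b % 3 = 0) := by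
    rcases ha with rfl | rfl
    · refine Or.inl ⟨rfl, ?_⟩
      by_contra hb; unfold cellS at hk; simp [hb] at hk
    · refine Or.inr ⟨rfl, ?_⟩
      by_contra hb; unfold cellS at hk; simp [hb] at hk
  intro x y hxy hx
  have h : y ^ 2 + 3 * (b : ℚ_[3]) * x * y + (3 : ℚ_[3]) ^ a * (A₃ : ℚ_[3]) * y = x ^ 3 := hxy
  have ha₁ : ‖(3 * (b : ℚ_[3]))‖ < 1 := by
    have e : ((3 * b : ℤ) : ℚ_[3]) = 3 * (b : ℚ_[3]) := by push_cast; ring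
    rw [← e, Padic.norm_intCast_lt_one_iff]
    exact ⟨b, by push_cast; ring⟩
  have ha₃ : ‖(3 : ℚ_[3]) ^ a * (A₃ : ℚ_[3])‖ ≤ 1 := by
    have e : ((3 ^ a * A₃ : ℤ) : ℚ_[3]) = (3 : ℚ_[3]) ^ a * (A₃ : ℚ_[3]) := by push_cast; ring
    rw [← e]; exact Padic.norm_int_le_one _
  by_cases hx1 : 1 < ‖x‖
  · obtain ⟨w, hw⟩ := ThreeTorsionNormalForm.exists_pow_three_eq_of_one_lt_norm ha₁ ha₃ h hx1
    exact ⟨0, w, by rw [hw]; ring⟩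
  have hx1' : ‖x‖ ≤ 1 := not_lt.1 hx1
  have hy1 : ‖y‖ ≤ 1 := norm_y_le_one ha₁.le ha₃ h hx1'
  set X : ℤ_[3] := ⟨x, hx1'⟩ with hXd
  set Y : ℤ_[3] := ⟨y, hy1⟩ with hYd
  have hXc : (X : ℚ_[3]) = x := rfl
  have hYc : (Y : ℚ_[3]) = y := rfl
  have hE : Y ^ 2 + 3 * (b : ℤ_[3]) * X * Y + 3 ^ a * (A₃ : ℤ_[3]) * Y = X ^ 3 := by
    apply PadicInt.ext
    push_cast
    rw [hXc, hYc]
    exact h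
  have hX0 : X ≠ 0 := by
    intro h0
    exact hx (by rw [← hXc, h0, PadicInt.coe_zero])
  have h30 : (3 : ZMod 3) = 0 := by decide
  have ha0 : a ≠ 0 := by rcases hcell with ⟨rfl, -⟩ | ⟨rfl, -⟩ <;> decide
  have hres : (PadicInt.toZMod Y) ^ 2 = (PadicInt.toZMod X) ^ 3 := by
    have := congrArg PadicInt.toZMod hE
    simpa only [map_add, map_mul, map_pow, map_ofNat, map_intCast, h30, zero_pow ha0, zero_mul, add_zero]
      using this
  rw [← hYc]
  rcases zmod3_points_S _ _ hres with ⟨hx0, hy0⟩ | ⟨hx1'', hy1''⟩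
  · rcases hcell with ⟨rfl, hb⟩ | ⟨rfl, hb⟩
    · exact lineS_one b A₃ hb hA hE hX0 hx0 hy0
    · exact lineS_two b A₃ hb hA hE hX0 hx0 hy0
  · obtain ⟨w, hw⟩ := cube_of_residue_one b A₃ a hcell hA hE hX0 hx1'' hy1''
    exact ⟨0, w, by rw [hw]; ring⟩

end CaseS

/-- **T30.6 v2 `FlexNFCaseSKummerSignedLawThree` PROVED AS TYPED.**  For `a ∈ {1, 2}`, `b ∈ ℤ`, `A₃ ≡ 1 (mod 3)`: the
Kummer image of `y² + 3b·xy + 3ᵃA₃·y = x³` over `ℚ₃` contains a très ramifié class (F-S1 `nfKummerHasRamified_S`), lies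
in the line of `[3ᵃA₃]` when `(cellS a b).k = 1` (`nfKummerInLineOfA₃_of_cellS`), and contains a unit class when
`(cellS a b).k = 2` (F-S1 `nfKummerHasUnit_S_of_cellS`).  A `_holds` for an O5 `@[conjecture]` node (the typer's v2
of T30.6, `O5/FlexNormalFormCaseSSignedLaw.lean`); closes no pair, moves no mark; census P-K19 stays EVIDENCE; the
any-sign reading follows by the node file's own `kummerLawS_of_signed`.
[cite: GajovicRadicevicVerzobio2025, Thm. 55 (arXiv:2502.08583 p. 21)] [cite: CohenPazuki2009ThreeDescent, Def. 1.3 and Prop. 2.2 (arXiv:0903.4963 pp. 4–5)] -/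
theorem flexNFCaseSKummerSignedLawThree_holds : FlexNFCaseSKummerSignedLawThree := by
  intro a b A₃ ha hA
  exact ⟨nfKummerHasRamified_S a b A₃ ha (by omega), nfKummerInLineOfA₃_of_cellS b A₃ a ha hA,
    nfKummerHasUnit_S_of_cellS a b A₃ ha hA⟩

/-- The ANY-SIGN reading (the node file's `kummerLawS_of_signed`) is now unconditional. [folklore] -/
theorem kummerLawS_anySign (a : ℕ) (b A₃ : ℤ) (ha : a = 1 ∨ a = 2) (hA : ¬ (3 : ℤ) ∣ A₃) :
    NFKummerHasRamified b A₃ a ∧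
      ((cellS a (b * A₃)).k = 1 → NFKummerInLineOfA₃ b A₃ a) ∧ ((cellS a (b * A₃)).k = 2 → NFKummerHasUnit b A₃ a) :=
  kummerLawS_of_signed flexNFCaseSKummerSignedLawThree_holds a b A₃ ha hA

end Summit.BirchSwinnertonDyer.Rank1Residual.O5.FlexNormalForm

end
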